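import Mathlib
import HarnessLib
import HarnessLib.Audit
import Summits.HubbardSuperconductivity.Statement
import Literature.MathematicalPhysics.QuantumLattice.KohnLuttinger
import Literature.MathematicalPhysics.QuantumLattice.DWaveSource
import Literature.Barriers.HubbardSuperconductivity.PureModelStripeCompetition
import Summits.HubbardSuperconductivity.HubbardSuperconductivity.Theorems.WeakCouplingBCSWcbcsThesisGlue
import Summits.HubbardSuperconductivity.HubbardSuperconductivity.Theorems.WeakCouplingBCSWcbcsTowerTrialBudget
import Summits.HubbardSuperconductivity.HubbardSuperconductivity.Theorems.WeakCouplingBCSAssembly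
import Summits.HubbardSuperconductivity.HubbardSuperconductivity.Theorems.WeakCouplingBCSWcbcsSourcedFreeGasCooperLog
import Summits.HubbardSuperconductivity.HubbardSuperconductivity.Theorems.WeakCouplingBCSWcbcsLegendreCeiling
import Summits.HubbardSuperconductivity.HubbardSuperconductivity.Theorems.WeakCouplingBCSKlCertDOSMassD010

/-!
Route: WeakCouplingBCS

DORMANT since 2026-09-03T17:56:42Z (reconciler: no traction for 5 d (last activity item-evidence-added at 2026-08-29T17:20:02Z); parked, not closed — `ledger route dormant route-HubbardSuperconductivity-WeakCouplingBCS --off` to reactiv) — unstaffed, not closed; items shared with open routes are served there. `ledger route dormant <id> --off` reactivates.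

# Route WeakCouplingBCS — HubbardSuperconductivity (survey 2026-08-13; rev 2 tenure alignment
2026-08-15; rev 3 deciding theorem 2026-08-15; rev 4 target glue 2026-08-16)

## Thesis X (it suffices to show) — aligned with the audited summit (even tori, δ ∈ (0,1/2))
There are U₀ > 0 and a hole doping δ ∈ (0, 1/2) such that for EVERY 0 < U < U₀ (weak repulsive
coupling) the summit's
matrix holds at (U, δ): every sequence of normalised (N_L, S^z = 0)-sector ground states of
`hubbardTorus 2 L 1 U`,
N_L = 2⌊(1-δ)L²/2⌋, L EVEN, has d_{x²-y²} pair-field long-range order along even sides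
(`Literature.Barriers.HubbardSuperconductivity.HasDWavePairFieldLROAt U δ`, word for word the body
of the summit).
X is the rank-0 target `WcbcsThesis`; it is reached from the two cruxes (crux 2 at the
density-matched μ of crux 4,
U-window = the smaller of the two) through the BY-NAME support item `WcbcsThesisGlue :
WcbcsSsbToTorusLRO →
WcbcsBcsConstruction → WcbcsThesis` (rev 4; pure logic, certified in the planner sketch), and X → S
is the instantiation U := U₀/2 (`HubbardSuperconductivity ↔ ∃ U>0,
∃ δ ∈ Ioo 0 (1/2), HasDWavePairFieldLROAt U δ` is `Iff.rfl`). DECIDING THEOREM (rev 3, D-0027 §2.1,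
native audit ok):
`closes : WcbcsSsbToTorusLRO → WcbcsBcsConstruction → HubbardSuperconductivity` (U := min(U₀,U₁)/2,
eight lines of logic).

Lean (elaborated rc0 in the planner sketch, 2026-08-15):
`∃ U₀ : ℝ, 0 < U₀ ∧ ∃ δ ∈ Set.Ioo (0:ℝ) (1 / 2), ∀ U ∈ Set.Ioo (0:ℝ) U₀,
Literature.Barriers.HubbardSuperconductivity.HasDWavePairFieldLROAt U δ`

## Why this line
PROBLEMS.md §3 line 1 (rigorous fermionic RG at weak U). At weak coupling the t'=0 square-lattice
Hubbard model is
believed to be a d_{x²-y²} BCS superconductor for generic δ by the Kohn–Luttinger mechanism, gap ~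
exp(-C/U²)
[KohnLuttinger1965, RaghuKivelsonScalapino2010, ArovasBergKivelsonRaghu2022]; this is the ONLY
regime where physicists
regard S as settled in the affirmative (at U≈8, δ≈1/8, t'=0 numerics see filled stripes, not SC
[QinEtAl2020, XuEtAl2024],
catalogued as Literature.Barriers.HubbardSuperconductivity.PureModelStripeCompetition — the reason
to sit at U → 0⁺).
Imported fields: constructive multiscale fermionic RG (2D Fermi liquid above the SC scale
[FeldmanKnorrerTrubowitz2004];
Hubbard-specific [BenfattoGiulianiMastropietro2006]); finite-size SSB theory [KomaTasaki1994,
Tasaki2019Tower] for the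
transfer crux; certified numerics for the Kohn–Luttinger channel selection (support).

## Ranked cruxes
2. (most informative; kill test) WcbcsSsbToTorusLRO — SSB ⇒ LRO transfer, stated qualitatively and
on EVEN tori:
   in a weak-coupling window, for every δ ∈ (0,1/2) and every chemical potential μ whose
grand-canonical tracial
   ground-state density tends to 1-δ, d-wave order m(U,μ) > 0 (pair source h → 0⁺ AFTER L → ∞,
   Literature.MathematicalPhysics.QuantumLattice.HasDWaveOrder) ⇒ HasDWavePairFieldLROAt U δ (every
even-L sector GS
   sequence has LRO). Only the converse (LRO ⇒ SSB, with LRO ≤ m² in the tree's normalisation) is a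
theorem
   [KomaTasaki1994 §0.7]. The density-matching hypothesis is what carries canonical ↔
grand-canonical equivalence and
   makes the claim vacuous exactly inside first-order density jumps (phase coexistence), where it
would otherwise fail.
4. (the research programme) WcbcsBcsConstruction — constructive BCS ground state: ∃ δ ∈ (0,1/2), U₀,
C > 0 with a
   density-matched μ and m(U,μ) ≥ exp(-C/U²) for all 0 < U < U₀ (no SC phase has been constructed
for any short-range
   lattice fermion model in d = 2; FKT/BGM stop above the SC scale).
Support (not staffed): WcbcsKohnLuttingerB1g (certified B₁g dominance of the order-U² Kohn–Luttinger
kernel on an explicit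
doping interval — channel SELECTION only; idea card holonomic-kohn-luttinger-certificate is routed
here as its tool);
WcbcsLegendreCeiling with its two finite-L lemmas WcbcsSourcedFreeGasCooperLog,
WcbcsTowerTrialBudget (card
probe-legendre-order-ceiling: L⁻⁴⟨Δ_g†Δ_g⟩ ≤ C·U·log(1/U) in every channel — calibration, provable
now).

## Kill criteria
- WcbcsSsbToTorusLRO refuted inside the Hubbard family at arbitrarily small U (density-matched GC
d-wave order with an
  even-L sector-GS sequence lacking LRO — e.g. a symmetry-protected equal-density coexistence, or an
S^z=0-sector
  tower/degeneracy effect) → pivot to a GS-uniqueness/gap hypothesis or close.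
- A theorem that m(U,μ) = 0 for all small U and all density-matched μ with 1-δ ∈ (1/2,1) (competing
instability always
  wins at weak coupling; or Kohn–Luttinger B₁g never leads at t'=0) → close.
- Certified B₁g NON-dominance for all δ ∈ (0,1/2) at t'=0 → close.

## Deliberately NOT decomposed yet
The multiscale RG itself (sectors/anisotropic scales, BCS-channel flow, Ward identities, the h > 0
infrared regulator),
the quantitative U₀, and any finite-volume gap/uniqueness by-product of the construction that would
prove crux 2.

## Change log
Rev 2 (tenure, 2026-08-15): summit audit (2026-08-13) moved S to δ ∈ (0,1/2), EVEN sides,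
HasLongRangeOrder over
halfOpenBox 2 (2k); rev-1 X had δ ∈ (0,1), all-L admissibility, HasPairFieldLRO, so X → S was short
of logic exactly by
the doping range (prover: wcbcsThesis_imp_summitShape_Ioo_one) and cruxes 2/4 copied the stale
block. Rev 2 restated X,
crux 2 (even L, δ<1/2, weak-coupling window, qualitative conclusion), crux 4 (δ<1/2) and dropped the
proved support
WcbcsSectorBookkeeping (stmt-0160: not load-bearing, and its `_holds` link cannot be rendered
because its proof module
imports this very file — the materialisation blocker of 2026-08-14/15).
Rev 3 (route-repair, 2026-08-15): the deciding theorem `closes (hSsb : WcbcsSsbToTorusLRO) (hBcs :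
WcbcsBcsConstruction) :
HubbardSuperconductivity` is supplied (hypotheses = the two cruxes BY NAME; conclusion = the
Statement decl; axioms ⊆
{propext, Classical.choice, Quot.sound}); the Assembly item is RESTATED by name to the same shape
(`WcbcsSsbToTorusLRO → WcbcsBcsConstruction → HubbardSuperconductivity`, rev-2 form `X → S` with X
inlined retired) and the
rev-2 support WcbcsCruxGlue (stmt-2011, `crux 2 → crux 4 → X` with all bodies inlined) is DROPPED as
superseded by
`closes` — it was trivial, and inlined bodies go stale at every restatement (the rev-1 → rev-2
lesson). Item set after
rev 3: target WcbcsThesis (0), Assembly (1), cruxes WcbcsSsbToTorusLRO (2), WcbcsBcsConstruction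
(4), support
WcbcsKohnLuttingerB1g (3), WcbcsLegendreCeiling (6), WcbcsSourcedFreeGasCooperLog (7),
WcbcsTowerTrialBudget (8).
Rev 4 (route-choice repair, 2026-08-16): after rev 3 no ITEM concluded the target (operator hold
`target-unreachable`
on WcbcsThesis: `closes` bypasses X, and the only glue into X had been dropped). Option (a) taken:
the glue is re-filed
BY NAME as the support item WcbcsThesisGlue (rank 9) `WcbcsSsbToTorusLRO → WcbcsBcsConstruction →
WcbcsThesis` — names,
not bodies, so it cannot go stale under a restatement of #0/#2/#4 (the defect that retired
WcbcsCruxGlue); it is pure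
logic (planner sketch, lean check rc 0: U₀ := min U₀ U₁, hasDWaveOrder_iff, Real.exp_pos; axioms ⊆
whitelist).
Nothing else changed: `closes`, both cruxes, X and the supports are untouched. Item set after rev 4:
target
WcbcsThesis (0), Assembly (1), cruxes WcbcsSsbToTorusLRO (2), WcbcsBcsConstruction (4), support
WcbcsKohnLuttingerB1g (3),
WcbcsLegendreCeiling (6), WcbcsSourcedFreeGasCooperLog (7), WcbcsTowerTrialBudget (8),
WcbcsThesisGlue (9).
PROVERS: close items of this route with theorems whose TYPE IS SPELLED OUT structurally (imports:
Summits.HubbardSuperconductivity.Statement + Literature modules); do NOT `import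
…Theses.WeakCouplingBCS` in a file that
closes an item — the gate links `<Decl>_holds := _root_.<your theorem>` by importing your module
into this file, and a
module that imports this file cycles. The rev-1 support files
Theorems/WeakCouplingBCSWcbcsThesis.lean and
Theorems/WeakCouplingBCSWcbcsSectorBookkeeping.lean import this file and destructure rev-1 bodies:
they need porting
(most lemmas survive verbatim) or retiring by a prover/operator.

Rationale: WHY THIS LINE. PROBLEMS.md §3 line 1: constructive fermionic RG at weak repulsive U
[FeldmanKnorrerTrubowitz2004,
BenfattoGiulianiMastropietro2006, Salmhofer1999] + Kohn–Luttinger channel selection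
[KohnLuttinger1965,
RaghuKivelsonScalapino2010 (arXiv:1002.0591), ArovasBergKivelsonRaghu2022 (arXiv:2103.12097)]
(certified, support) + a
Koma–Tasaki-type transfer [KomaTasaki1994 (arXiv:cond-mat/9708132), Tasaki2019Tower
(arXiv:1807.05847)] from grand-canonical
source-field order to canonical even-torus pair-field LRO. Weak coupling is the one regime where S
is believed true
(d_{x²−y²} by Kohn–Luttinger at t'=0 for 0.6 < n < 1, gap ~ e^{−C/U²}), far from the filled-stripe
regime U ≈ 8, δ = 1/8
of QinEtAl2020 (Literature.Barriers.HubbardSuperconductivity.PureModelStripeCompetition). Imported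
areas: constructive QFT /
multiscale fermionic RG (analysis) for the construction, finite-volume SSB theory (Koma–Tasaki) for
the transfer, interval
arithmetic for the channel selection. The line sits at U → 0⁺ with an explicit BCS scale and files
the canonical ↔
grand-canonical step as a stated crux instead of assuming it; the negatives index (1 entry,
AposterioriCapRg openness,
stmt-1314) does not touch it.
RANKED CRUXES. #2 WcbcsSsbToTorusLRO — ∃U₀>0 ∀U∈(0,U₀) ∀δ∈(0,1/2) ∀μ: grand-canonical tracial
ground-state density of
hubbardTorusWith 2 (L+1) 1 U μ → 1−δ and HasDWaveOrder U μ ⇒ HasDWavePairFieldLROAt U δ (why it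
might fail: only
LRO ⇒ SSB is a theorem, KomaTasaki1994 §0.7 Cor. 9 with Conjecture 10 open; an even-L S^z=0
sector-GS sequence may sit in a
coexisting non-d-wave phase at an equal-density first-order point or lose LRO to a tower of states —
Tasaki2019Tower,
WreszinskiZagrebnov2016 Rem. 4.5). Rank 2 because it is the cheapest place for the line to die (a
Hubbard-family
counterexample needs no construction) and the one place where the literature is one-directional. #4
WcbcsBcsConstruction —
∃δ∈(0,1/2) ∃U₀,C>0 ∀U∈(0,U₀) ∃μ: density-matched and dWaveOrderParameter U μ ≥ e^{−C/U²} (why it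
might fail: no convergent
expansion reaches below T ~ e^{−a/U} — BenfattoGiulianiMastropietro2006 Thm 1.1,
Literature.Barriers.HubbardSuperconductivity.WeakCouplingCeiling; needs ONE δ good for all small U
and fails where the B₁g
coupling vanishes — FeldmanKnorrerTrubowitz2004 Thm I, Salmhofer1999 §4.5.4/§4.8.2, Mastropietro2008
Ch. 15). Rank 4 = the
research programme, staffed once rank 2 survives refuters. Deciding theorem (rev 3): `closes :
WcbcsSsbToTorusLRO →
WcbcsBcsConstruction → HubbardSuperconductivity` — U := min(U₀,U₁)/2 at the density-matched μ of #4,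
m ≥ e^{−C/U²} > 0 gives
HasDWaveOrder, #2 gives HasDWavePairFieldLROAt U δ, and the summit is ∃U>0 ∃δ∈Ioo 0 (1/2)
HasDWavePairFieldLROAt U δ by
Iff.rfl; #1 Assembly is restated by name to exactly this shape, and the rev-2 support WcbcsCruxGlue
(bodies inlined) is
superseded by it and dropped; rev 4 re-files that glue BY NAME as #9 WcbcsThesisGlue : #2 → #4 → #0
(pure logic), so the
target X is again concluded by an item of the route. Design choices (rev 2,
kept): (i) X = the summit matrix made uniform on a weak-coupling window — nothing stronger; (ii) #2
is QUALITATIVE (order ⇒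
LRO > 0; the sharp LRO = m² is not filed); (iii) #2 carries the canonical ↔ grand-canonical step
through density matching,
vacuous inside a GC density jump (e.g. the d_{x²−y²}/d_xy boundary δ_c(U) ≈ 0.4 of
RaghuKivelsonScalapino2010 Fig. 2);
(iv) both cruxes live on ∃U₀-windows so finite-volume gap / sector-GS uniqueness by-products of #4
are admissible proofs of #2.
SUPPORT. #0 WcbcsThesis = X (target; follows mechanically from #2 + #4 through #9 — do not attack
directly); #9
WcbcsThesisGlue — `WcbcsSsbToTorusLRO → WcbcsBcsConstruction → WcbcsThesis` by item name, provable
now in five lines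
(U₀ := min U₀ U₁; the density-matched μ of #4; e^{−C/U²} > 0 ⇒ HasDWaveOrder via hasDWaveOrder_iff;
then #2), certified in
the planner sketch; #3 WcbcsKohnLuttingerB1g —
certified B₁g dominance of the order-U² Kohn–Luttinger kernel on an explicit doping interval
(channel SELECTION only; card
holonomic-kohn-luttinger-certificate; printed uncontested ordering RaghuKivelsonScalapino2010 Fig.
2, new only as a
certificate); #6 WcbcsLegendreCeiling ⇐ #7 WcbcsSourcedFreeGasCooperLog + #8 WcbcsTowerTrialBudget
(card
probe-legendre-order-ceiling: L⁻⁴⟨Δ_g†Δ_g⟩ ≤ C·U·log(1/U) in every channel for every sector ground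
state, finite L, provable
now; calibrates both cruxes, consistent with e^{−C/U²}).
KILL CRITERIA. (i) WcbcsSsbToTorusLRO refuted inside the Hubbard family at arbitrarily small U (a
density-matched μ with
grand-canonical d-wave order and an even-L sector-GS sequence lacking LRO — a symmetry-protected
equal-density coexistence, or
an S^z=0-sector tower/degeneracy effect): one pivot to a GS-uniqueness / spectral-gap version of #2,
else close
refuted:WcbcsSsbToTorusLRO. (ii) A theorem that m(U,μ) = 0 for all small U and all density-matched μ
with 1−δ ∈ (1/2,1)
(a competing instability always wins at weak coupling, or Kohn–Luttinger B₁g never leads at t'=0):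
close
refuted:WcbcsBcsConstruction. (iii) Certified B₁g NON-dominance for every δ ∈ (0,1/2) at t'=0:
close. (iv) Mooted if another
route proves S at some (U, δ) first.
NOT DECOMPOSED YET. The multiscale RG itself (sectors / anisotropic scales, BCS-channel flow, Ward
identities, the h > 0
infrared regulator and the order of limits L → ∞ then h ↓ 0), the quantitative U₀ and C, the choice
of δ inside the B₁g
window and off any grand-canonical density jump, and any finite-volume gap / sector-GS uniqueness
by-product of the
construction that would prove #2 — all are layer-2 children of #4 / #2, filed as glued splits (k ≤
3) only after one of
them moves.
CHEAPEST FALSIFIER. A floating-point (uncertified) diagonalisation of the second-order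
Kohn–Luttinger kernel
Γ_U(k,k′) = U + U²χ₀(k+k′) on the t'=0 Fermi curve, per D₄ irrep, at δ ∈ {0.05, 0.10, …, 0.45}: if
B₁g is not the most
attractive channel on any sub-interval of (0,1/2), kill criterion (iii) fires before any certificate
or construction is
attempted (one kit job, hours). Not run by this repair seat; the printed non-rigorous answer is
d_{x²−y²} leading for
0 < δ ≲ 0.4 (RaghuKivelsonScalapino2010 §III Fig. 2, arXiv:1002.0591 p. 6). Second cheapest, aimed
at #2: exact
diagonalisation of the 4×4 torus at small U looking for S^z=0 sector ground-state degeneracy at N =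
2⌊8(1−δ)⌋ (the named
tower/degeneracy failure mode) — indicative only at L = 4.
SOURCES. RaghuKivelsonScalapino2010 (arXiv:1002.0591 §II–III), ArovasBergKivelsonRaghu2022
(arXiv:2103.12097 §5.1),
BenfattoGiulianiMastropietro2006 (Thm 1.1), FeldmanKnorrerTrubowitz2004 (Thm I), Salmhofer1999
§4.5.4/§4.8.2, Mastropietro2008
Ch. 15, KomaTasaki1994 (arXiv:cond-mat/9708132 §0.7), Tasaki1998, Tasaki2019Tower
(arXiv:1807.05847), WreszinskiZagrebnov2016
(arXiv:1607.03024), QinEtAl2020, KohnLuttinger1965; nearest rigorous SC-LRO result (attractive U,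
Lieb lattice, half
filling, reflection positivity): arXiv:2509.19780 — calibration only. The route-level prior-art and
barrier texts of the
2026-08-14 retriage stand unchanged; read "odd L" there as superseded by the even-L alignment of rev
2.

Novelty: Nearest prior art (searched this pass: `lit search "Kohn-Luttinger superconductivity repulsive model
rigorous renormalization group Feldman Knörrer Sinclair Trubowitz" [--source all: remote APIs 429,
local hits]`, `lit search --hybrid "Kohn-Luttinger d-wave superconductivity weak coupling Hubbard
square lattice renormalization group asymptotically exact"`, `lit vsearch "rigorous proof of
superconducting long-range order in the ground state of a lattice fermion model with short-range
interaction"`, `lit search "long-range order symmetry breaking tower of states Tasaki" --source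
local`, `lit frontier HubbardSuperconductivity --since 2018`, `lit bridges HubbardSuperconductivity
--cross any`, `lit galaxy search "Bose-Einstein condensation and spontaneous symmetry breaking"
--star pdf`; `lit read` of every hit named below). (1) The MECHANISM is printed and non-rigorous:
RaghuKivelsonScalapino2010 §II–III (arXiv:1002.0591 pp. 4–6) — second-order Kohn–Luttinger vertex U
+ U²χ₀(k+k′) on the Fermi curve, d_{x²−y²} leading at t′=0 for 1>n>0.6, "asymptotically exact" under
stated assumptions; ArovasBergKivelsonRaghu2022 §5.1 (arXiv:2103.12097 pp. 9–13), T_{c,+} ~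
exp[−1/(αρ²U²)]. (2) The RIGOROUS side stops above the superconducting scale or switches the Cooper
channel off: BenfattoGiulianiMastropietro2006 Thm 1.1 (Hubbard, T ≥ e^{−a/|U|}, and only at density
< 1/4 per Literature.Barriers.HubbardSuperconductivity.WeakCouplingCeiling scope),
FeldmanKnorrerTrubowitz2004 Thm I (T = 0 Fermi  [refs: 1002.0591, 2103.12097, cond-mat/9708132, 1607.03024, RaghuKivelsonScalapino2010, ArovasBergKivelsonRaghu2022, BenfattoGiulianiMastropietro2006, FeldmanKnorrerTrubowitz2004, Salmhofer1999, Mastropietro2008, KomaTasaki1994, WreszinskiZagrebnov2016]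

Barriers (technique_class: constructive-RG; symmetry-breaking-field; certified-numerics): Catalogue Literature/Barriers/HubbardSuperconductivity/ (9 entries read this pass); one line per
entry.
Literature.Barriers.HubbardSuperconductivity.WeakCouplingCeiling: APPLIES head-on to crux
WcbcsBcsConstruction (Cooper logarithm; convergent weak-coupling/constructive-RG expansions are
proved only for β⁻¹ ≥ e^{−a/|U|}, BGM2006 Thm 1.1, and only at density < 1/4 — nothing in the summit
window δ ∈ (0,1/2) at any scale) and is NOT evaded: the bet is a two-regime scheme — a convergent
multiscale expansion down to a scale K·e^{−C/U²} at which the B₁g particle–particle ladder is still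
in Salmhofer's region |λ_d log(βε₀)| < const (Salmhofer1999 (4.175), §4.8.2), then an explicitly
symmetry-broken expansion around a gapped d-wave reference state in which the Koma–Tasaki source h >
0 of Literature.MathematicalPhysics.QuantumLattice.dWaveSourceTorus is the infrared regulator of the
Cooper channel (as the long-range BCS term is in Mastropietro2008 Ch. 15), limits L → ∞ then h ↓ 0
exactly as in Literature.MathematicalPhysics.QuantumLattice.dWaveOrderParameter; no source prints a
theorem that a reorganised expansion cannot converge below e^{−a/|U|} (this entry's scope_caveats),
so the barrier bounds the known technique, not the statement.
Literature.Barriers.HubbardSuperconductivity.PerturbativeInvisibilityOfPairing: APPLIES (its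
`blocks` names this route's crux #4): the scale e^{−C/U²} is flat at U = 0⁺, invisible to
Literature.Barriers.QuantumFields.IsPerturbativelyVisibleAt0; EVADED

Novelty grade: new-combination — route-review refuter rev 3 (2026-08-16): KEEP OPEN. All 8 decls rc0; Assembly 10544 = type of in-file `closes` (native OK; structural replica attached). Not a recombination of a closed route (closed Hubbard routes EomCeiling/GSCertificate/KineticMerminWagner/MottCornerCeiling/OneSidedBootstrap/PairB (refuter refuter-rreview1-HubbardSuperconductivity-WeakC-822f3ecf-0, 2026-08-16T03:28:49Z; prior: arXiv:1002.0591 (RaghuKivelsonScalapino2010), arXiv:2103.12097 (ArovasBergKivelsonRaghu2022), arXiv:cond-mat/0507686 (BenfattoGiulianiMastropietro2006), arXiv:math-ph/0209047 (FeldmanKnorrerTrubowitz2004), arXiv:cond-mat/9708132 (KomaTasaki1994), Mastropietro2008 ch. 15, arXiv:cond-mat/9312044 (BachLiebSolovej1994))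

History (route lifecycle, newest last):
- 2026-08-15T11:00:15Z · rev 2: restated WcbcsThesis (stmt-HubbardSuperconductivity-0120), Assembly (stmt-HubbardSuperconductivity-0156), WcbcsSsbToTorusLRO (stmt-HubbardSuperconductivity-0157), WcbcsBcsConstruction (stmt-HubbardSuperconductivity-0159) — rev 2 (tenure): align X/Assembly/cruxes with the audited summit (EVEN tori, δ∈Ioo 0 (1/2)) (planner-plan-HubbardSuperconductivity-0)
- 2026-08-15T11:00:15Z · rev 2: dropped WcbcsSectorBookkeeping — rev 2 (tenure): align X/Assembly/cruxes with the audited summit (EVEN tori, δ∈Ioo 0 (1/2)); restate WcbcsThesis=X′ (HasDWavePairFieldLROAt, weak-coupling window (planner-plan-HubbardSuperconductivity-0)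
- 2026-08-15T16:18:10Z · rev 3: restated Assembly (stmt-HubbardSuperconductivity-2008) — rev 3 (route-repair, glue): deciding theorem closes : WcbcsSsbToTorusLRO -> WcbcsBcsConstruction -> HubbardSuperconductivity supplied (hypotheses = the two crux (planner-rbadge-HubbardSuperconductivity-WeakCo-822f3ecf-g2-0)
- 2026-08-15T16:18:10Z · rev 3: dropped WcbcsCruxGlue — rev 3 (route-repair, glue): deciding theorem closes : WcbcsSsbToTorusLRO -> WcbcsBcsConstruction -> HubbardSuperconductivity supplied (hypotheses = the two crux (planner-rbadge-HubbardSuperconductivity-WeakCo-822f3ecf-g2-0)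
- 2026-09-03T17:56:42Z · DORMANT — reconciler: no traction for 5 d (last activity item-evidence-added at 2026-08-29T17:20:02Z); parked, not closed — `ledger route dormant route-HubbardSuperconduc (operator:999:2678125)

sub-problem: HubbardSuperconductivity · status: dormant · opened planner-HubbardSuperconductivity-Survey-0 2026-08-13T06:04:21Z · rev 7 · ledger route-HubbardSuperconductivity-WeakCouplingBCS
GENERATED by the gate from the ledger (D-0016/17). Provers cite these decls: `theorem foo : Summit.HubbardSuperconductivity.HubbardSuperconductivity.Theses.WeakCouplingBCS.<Decl> := …` in Summits/HubbardSuperconductivity/HubbardSuperconductivity/Theorems/<Name>.lean.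
-/

namespace Summit.HubbardSuperconductivity.HubbardSuperconductivity.Theses.WeakCouplingBCS

open scoped BigOperators Topology Manifold Classical MeasureTheory ProbabilityTheory Matrix InnerProductSpace ComplexConjugate ContinuousMap
open Filter Set Function TopologicalSpace MeasureTheory

attribute [summit_statement] _root_.HubbardSuperconductivity

open Literature.Hubbard

-- earlier WcbcsThesis (stmt-HubbardSuperconductivity-0120, replaced 2026-08-15T11:00:15Z -> stmt-HubbardSuperconductivity-2007): retired by None — ∃ U₀ : ℝ, 0 < U₀ ∧ ∃ δ ∈ Set.Ioo (0:ℝ) 1, ∀ U ∈ Set.Ioo (0:ℝ) U₀, ∀ (N : ℕ → ℕ) (ψ : ∀ L, Literature.MathematicalPhysics.QuantumLattice.Fock (Literature.MathematicalPhysics.QuantumLattice.Orb (Literature.MathematicalPhysics.QuantumLattice.FermionTorus 2 L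
/-- item stmt-HubbardSuperconductivity-2007 · target · rank 0 · open · by planner
why it might fail: Open both ways: no SC phase is constructed for any 2D short-range lattice fermion model (BGM2006 stops at T ≥ e^{-a/U}); X is uniform in U on (0,U₀) at ONE δ — fails if the B1g doping window drifts with U or a competing order wins along some U_n → 0⁺.
sources: RaghuKivelsonScalapino2010 §II–III, Fig. 2 (arXiv:1002.0591 pp. 4–6), ArovasBergKivelsonRaghu2022 §5.1 (arXiv:2103.12097 pp. 9–13), BenfattoGiulianiMastropietro2006 Thm 1.1 (arXiv:cond-mat/0507686 p. 3), KomaTasaki1994 §0.7 (arXiv:cond-mat/9708132 pp. 11–12), Literature.Barriers.HubbardSuperconductivity.HasDWavePairFieldLROAt (PureModelStripeCompetition.lean: the summit matrix at fixed (U, δ)), Literature.Barriers.HubbardSuperconductivity.WeakCouplingCeiling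
[target] X (rev 2, aligned with the audited summit): there are U₀ > 0 and δ ∈ (0,1/2) such that for
EVERY 0 < U < U₀ the summit matrix HasDWavePairFieldLROAt U δ holds — every sequence of normalised
(N_L, S^z=0)-sector ground states of hubbardTorus 2 L 1 U on EVEN tori, N_L = 2⌊(1-δ)L²/2⌋, has
d_{x²-y²} pair-field long-range order along even sides (liminf_k (2k)⁻⁴ Re⟨ψ_{2k}, Δ_d†Δ_d ψ_{2k}⟩ >
0). The summit is ∃U>0 ∃δ∈(0,1/2) HasDWavePairFieldLROAt U δ (Iff.rfl); X adds only uniformity in U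
on a weak-coupling window (Kohn–Luttinger/BCS regime, gap ~ e^{-C/U²}). Open mathematics; it closes
mechanically from cruxes 2 + 4 through the support item WcbcsCruxGlue, so provers should not attack
it directly before those close. PROVER/REFUTER: spell the type out; do NOT import the Theses file
(see header). Sources: RaghuKivelsonScalapino2010 §II–III, ArovasBergKivelsonRaghu2022 §5.1,
BenfattoGiulianiMastropietro2006 Thm 1.1. -/
@[route_item "route-HubbardSuperconductivity-WeakCouplingBCS"]
def WcbcsThesis : Prop :=
  ∃ U₀ : ℝ, 0 < U₀ ∧ ∃ δ ∈ Set.Ioo (0:ℝ) (1 / 2), ∀ U ∈ Set.Ioo (0:ℝ) U₀, Literature.Barriers.HubbardSuperconductivity.HasDWavePairFieldLROAt U δ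

-- earlier WcbcsSsbToTorusLRO (stmt-HubbardSuperconductivity-0157, replaced 2026-08-15T11:00:15Z -> stmt-HubbardSuperconductivity-2009): retired by None — ∀ (U δ μ : ℝ), δ ∈ Set.Ioo (0:ℝ) 1 → Filter.Tendsto (fun L : ℕ => ((Literature.MathematicalPhysics.QuantumLattice.hubbardTorusWith 2 (L + 1) 1 U μ).groundStateFunctional Literature.MathematicalPhysics.QuantumLattice.totalNumber).re / ((L + 1 : ℕ) :
/-- item stmt-HubbardSuperconductivity-2009 · crux · rank 2 · open · by planner
why it might fail: Not a theorem in this direction (KT1994: only LRO⇒SSB; Conj. 10 open): an even-L S^z=0-sector GS sequence may sit in a coexisting non-d-wave phase at an equal-density first-order point (not excluded by density matching) or lose LRO to a tower of states; GC density at such μ may not converge.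
sources: KomaTasaki1994 §0.7 Cor. 9, Remark 2, Conjecture 10 (arXiv:cond-mat/9708132 pp. 11–12), Tasaki1998 p. 16 (after Thm 5.2), Tasaki2019Tower §1, §3 (arXiv:1807.05847), WreszinskiZagrebnov2016 Remark 4.5 (arXiv:1607.03024), RaghuKivelsonScalapino2010 §III Fig. 2 (arXiv:1002.0591 p. 6: d_{x²-y²} for 1>n>0.6, d_xy below — a first-order boundary inside δ∈(0,1/2)), Literature.Barriers.HubbardSuperconductivity.LROForcesLowLyingStates
[crux] SSB ⇒ LRO transfer (rev 2: even tori, δ<1/2, weak-coupling window, QUALITATIVE). ∃U₀>0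
∀U∈(0,U₀) ∀δ∈(0,1/2) ∀μ: IF the grand-canonical tracial ground-state density Re ω₀(N)/(L+1)² of
hubbardTorusWith 2 (L+1) 1 U μ tends to 1-δ (density matching = the canonical↔GC step; vacuous
inside a first-order GC density jump — how the claim survives phase coexistence, e.g. the
d_{x²-y²}/d_xy boundary δ_c(U)≈0.4 of RKS2010 Fig. 2) AND the Koma–Tasaki order parameter m(U,μ) =
liminf_{h→0⁺} liminf_L Re ω_{L,h}(Δ_d)/L² is positive (HasDWaveOrder; source -h(Δ_d+Δ_d†), L→∞
FIRST), THEN HasDWavePairFieldLROAt U δ: every normalised even-L (N_L,S^z=0)-sector GS sequence of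
the source-free canonical model has liminf_k (2k)⁻⁴ Re⟨ψ_{2k},Δ_d†Δ_d ψ_{2k}⟩ > 0. Expected truth
LRO = m² (KT1994: LRO ≤ m² in this normalisation, i.e. LRO⇒SSB; the sharp converse 'm² ≤ liminf' is
in the planner sketch, implies this item; positivity is all the route needs). SSB⇒LRO for
finite-volume GS is NOT a theorem (KT1994 Conj. 10; Tasaki2019Tower). Weak-coupling proofs may use
by-products of crux 4 (finite-volume gap / sector-GS uniqueness). PROVER/REFUTER: spell the type
out; do NOT import the Theses file (see header). -/
@[route_item "route-HubbardSuperconductivity-WeakCouplingBCS"]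
def WcbcsSsbToTorusLRO : Prop :=
  ∃ U₀ : ℝ, 0 < U₀ ∧ ∀ U ∈ Set.Ioo (0:ℝ) U₀, ∀ δ ∈ Set.Ioo (0:ℝ) (1 / 2), ∀ μ : ℝ, Filter.Tendsto (fun L : ℕ => ((Literature.MathematicalPhysics.QuantumLattice.hubbardTorusWith 2 (L + 1) 1 U μ).groundStateFunctional Literature.MathematicalPhysics.QuantumLattice.totalNumber).re / ((L + 1 : ℕ) : ℝ) ^ 2) Filter.atTop (nhds (1 - δ)) → Literature.MathematicalPhysics.QuantumLattice.HasDWaveOrder U μ → Literature.Barriers.HubbardSuperconductivity.HasDWavePairFieldLROAt U δ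

-- earlier WcbcsBcsConstruction (stmt-HubbardSuperconductivity-0159, replaced 2026-08-15T11:00:15Z -> stmt-HubbardSuperconductivity-2010): retired by None — ∃ δ ∈ Set.Ioo (0:ℝ) 1, ∃ U₀ : ℝ, 0 < U₀ ∧ ∃ C : ℝ, 0 < C ∧ ∀ U ∈ Set.Ioo (0:ℝ) U₀, ∃ μ : ℝ, Filter.Tendsto (fun L : ℕ => ((Literature.MathematicalPhysics.QuantumLattice.hubbardTorusWith 2 (L + 1) 1 U μ).groundStateFunctional Literature.Mathematic
/-- item stmt-HubbardSuperconductivity-2010 · crux · rank 4 · open · by planner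
why it might fail: No convergent expansion reaches below T ~ e^{-a/U} (Cooper logarithm; BGM2006 Thm 1.1 only for T ≥ e^{-a/|U|} and small density); needs ONE δ < 1/2 good for all small U with a density-matched μ along all L (fails at a density jump) and m ≥ e^{-C/U²} (false if the B₁g coupling vanishes at that δ).
sources: BenfattoGiulianiMastropietro2006 Thm 1.1 (arXiv:cond-mat/0507686 p. 3), FeldmanKnorrerTrubowitz2004 Thm I + Hypothesis p. 8 (arXiv:math-ph/0209047), Salmhofer1999 §4.5.4 p. 140 (Feldman–Knörrer–Sinclair–Trubowitz, Helv. Phys. Acta 70 (1997) 154) and §4.8.2 pp. 162–163, Mastropietro2008 p. 30 and Ch. 15, ArovasBergKivelsonRaghu2022 §5.1.1 (T_{c,+} ~ exp[-1/(αρ²U²)], arXiv:2103.12097 p. 10), Literature.Barriers.HubbardSuperconductivity.WeakCouplingCeiling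
[crux] Constructive BCS ground state at weak coupling (rev 2: δ<1/2 so the glue reaches the summit).
∃δ∈(0,1/2) ∃U₀>0 ∃C>0 ∀U∈(0,U₀) ∃μ: the GC tracial ground-state density of hubbardTorusWith 2 (L+1)
1 U μ tends to 1-δ AND dWaveOrderParameter U μ ≥ exp(-C/U²) (⇒ HasDWaveOrder). This IS the research
programme: a convergent multiscale expansion down to a scale K·e^{-C/U²} where the B₁g
particle–particle ladder is still perturbative (Salmhofer1999 (4.175), §4.8.2), then a
symmetry-broken expansion around a gapped d_{x²-y²} reference state with the Koma–Tasaki source h>0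
(dWaveSourceTorus) as infrared regulator of the Cooper channel, limits L→∞ then h↓0 as in
dWaveOrderParameter. OPEN: FKT2004 Thm I (T=0 Fermi liquid only for strongly asymmetric Fermi
curves), BGM2006 Thm 1.1 (Hubbard, T ≥ e^{-a/|U|}), FKST1997 (flow TO an instability, Salmhofer1999
§4.5.4), Mastropietro2008 Ch. 15 (SSB only with long-range BCS term). Choose δ inside the B₁g window
of WcbcsKohnLuttingerB1g and off any GC density jump. PROVER/REFUTER: spell the type out; do NOT
import the Theses file (see header). -/
@[route_item "route-HubbardSuperconductivity-WeakCouplingBCS"]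
def WcbcsBcsConstruction : Prop :=
  ∃ δ ∈ Set.Ioo (0:ℝ) (1 / 2), ∃ U₀ : ℝ, 0 < U₀ ∧ ∃ C : ℝ, 0 < C ∧ ∀ U ∈ Set.Ioo (0:ℝ) U₀, ∃ μ : ℝ, Filter.Tendsto (fun L : ℕ => ((Literature.MathematicalPhysics.QuantumLattice.hubbardTorusWith 2 (L + 1) 1 U μ).groundStateFunctional Literature.MathematicalPhysics.QuantumLattice.totalNumber).re / ((L + 1 : ℕ) : ℝ) ^ 2) Filter.atTop (nhds (1 - δ)) ∧ Real.exp (-C / U ^ 2) ≤ Literature.MathematicalPhysics.QuantumLattice.dWaveOrderParameter U μ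

/-- item stmt-HubbardSuperconductivity-0158 · support · rank 3 · open · by planner
sources: RaghuKivelsonScalapino2010 §III + Fig. 2 (arXiv:1002.0591 p. 6), ArovasBergKivelsonRaghu2022 §5.1.3 Fig. 1(a) (arXiv:2103.12097 p. 13), Literature.MathematicalPhysics.QuantumLattice.channelInf / kohnLuttingerKernel / D4Irrep (KohnLuttinger.lean), Salmhofer1999 §4.5.4 p. 140
Let ε(k) = −2(cos k₁ + cos k₂), μ(δ) the chemical potential with density 1−δ, F = {ε = μ} the Fermi
curve with measure dσ = ds/|∇ε|, χ₀(q) the static Lindhard function of ε at μ, and Γ_U(k,k') = U +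
U² χ₀(k + k') the second-order Kohn–Luttinger pairing kernel as a self-adjoint integral operator on
L²(F, dσ). CLAIM: there is a non-empty explicit interval I ⊂ (0,1) (expected to contain [0.05,
0.35]) and γ > 0 such that for δ ∈ I the coefficient of U² in the lowest eigenvalue of Γ_U
restricted to the B₁g (x²−y²) isotypic component of D₄ is < −γ below the corresponding coefficient
in each of A₁g, A₂g, B₂g, E. Deliverable = interval-arithmetic certificate. Raghu–Kivelson–Scalapino
report d_{x²−y²} leading for 0 < δ ≲ 0.5 at t'=0 (their Fig. 2), non-rigorously. ||
needs_definition: Literature.MathematicalPhysics.QuantumLattice.kohnLuttingerKernel (def request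
filed: lindhardFunction, fermiCurveMeasure, kohnLuttingerKernel). || Sources:
RaghuKivelsonScalapino2010, KohnLuttinger1965. -/
@[route_item "route-HubbardSuperconductivity-WeakCouplingBCS"]
def WcbcsKohnLuttingerB1g : Prop :=
  ∃ a b γ U₁ : ℝ, 0 < a ∧ a < b ∧ b < 1 ∧ 0 < γ ∧ 0 < U₁ ∧ ∀ δ ∈ Set.Icc a b, ∀ U ∈ Set.Ioo (0:ℝ) U₁, ∀ χ : Literature.MathematicalPhysics.QuantumLattice.D4Irrep, χ ≠ Literature.MathematicalPhysics.QuantumLattice.D4Irrep.B1g → Literature.MathematicalPhysics.QuantumLattice.channelInf (Literature.MathematicalPhysics.QuantumLattice.squareDispersion 1 0) (Literature.MathematicalPhysics.QuantumLattice.chemicalPotentialOfDensity (Literature.MathematicalPhysics.QuantumLattice.squareDispersion 1 0) (1 - δ)) U Literature.MathematicalPhysics.QuantumLattice.D4Irrep.B1g + γ * U ^ 2 ≤ Literature.MathematicalPhysics.QuantumLattice.channelInf (Literature.MathematicalPhysics.QuantumLattice.squareDispersion 1 0) (Literature.MathematicalPhysics.QuantumLattice.chemicalPotentialOfDensity (Literature.MathematicalPhysics.QuantumLattice.squareDispersion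 1 0) (1 - δ)) U χ

/-- item stmt-HubbardSuperconductivity-1197 · support · rank 6 · closed · proved by Summit.HubbardSuperconductivity.HubbardSuperconductivity.Theorems.WcbcsLegendre.wcbcsLegendreCeiling_proof (prover) · by planner
[support] LEGENDRE CEILING (realises idea card probe-legendre-order-ceiling as calibration; provable
now). For every form factor g and doping δ∈(0,1) there are C, U₀ such that for 0<U<U₀ and all large
L EVERY normalised (N_L, S^z=0)-sector ground state ψ of hubbardTorus 2 L 1 U (N_L = 2⌊(1−δ)L²/2⌋,
any parity of L) has L⁻⁴⟨ψ, Δ_g†Δ_g ψ⟩ ≤ C·U·log(1/U): the pair order of the weakly repulsive 2D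
Hubbard ground states is perturbatively small in every channel, uniformly over the choice of ground
state. For this route: m(U,δ)² ≤ liminf L⁻⁴⟨Δ_d†Δ_d⟩ ≤ C U log(1/U) (calibrates WcbcsSsbToTorusLRO /
WcbcsBcsConstruction; consistent with e^{−C/U²}); for GSCertificate: no certificate margin a > C U
log(1/U) below U₀; for NoGo: the quantitative weak-coupling member of its regional map (LRO → 0 as U
→ 0⁺ uniformly in the ground state). PROOF (one page, finite L, no expansion, no reflection
positivity): WcbcsTowerTrialBudget (trial state Ξ = (ψ + Oψ/‖Oψ‖)/√2, O = Δ_g + Δ_g†, U·Σn↑n↓ ≥ 0,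
Slater upper bound) + WcbcsSourcedFreeGasCooperLog (the free gas with pair source h gains at most
C_B h² log(1/h) per site over the canonical free energy at the finite-L Fermi level): h‖Oψ‖ ≤ L²[U +
C_B h² log(1 -/
@[route_item "route-HubbardSuperconductivity-WeakCouplingBCS"]
def WcbcsLegendreCeiling : Prop :=
  ∀ (g : Literature.Probability.LatticeModels.Site 2 → ℝ) (δ : ℝ), δ ∈ Set.Ioo (0:ℝ) 1 → ∃ C U₀ : ℝ, 0 < U₀ ∧ U₀ < 1 ∧ ∀ U : ℝ, U ∈ Set.Ioo (0:ℝ) U₀ → ∃ L₀ : ℕ, ∀ L : ℕ, L₀ ≤ L → ∀ ψ : Literature.MathematicalPhysics.QuantumLattice.Fock (Literature.MathematicalPhysics.QuantumLattice.Orb (Literature.MathematicalPhysics.QuantumLattice.FermionTorus 2 (L + 1))), Literature.MathematicalPhysics.QuantumLattice.IsGroundStateInSector (Literature.MathematicalPhysics.QuantumLattice.hubbardTorus 2 (L + 1) 1 U) (2 * ⌊(1 - δ) * ((L + 1 : ℕ) : ℝ) ^ 2 / 2⌋₊) 0 ψ → star ψ ⬝ᵥ ψ = 1 → (Literature.MathematicalPhysics.QuantumLattice.expect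 (Matrix.conjTranspose (Literature.MathematicalPhysics.QuantumLattice.pairField g (L + 1)) * Literature.MathematicalPhysics.QuantumLattice.pairField g (L + 1)) ψ).re / ((L + 1 : ℕ) : ℝ) ^ 4 ≤ C * U * Real.log (1 / U)

/-- `WcbcsLegendreCeiling` holds: proved by `Summit.HubbardSuperconductivity.HubbardSuperconductivity.Theorems.WcbcsLegendre.wcbcsLegendreCeiling_proof`. -/
theorem WcbcsLegendreCeiling_holds : WcbcsLegendreCeiling := _root_.Summit.HubbardSuperconductivity.HubbardSuperconductivity.Theorems.WcbcsLegendre.wcbcsLegendreCeiling_proof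

/-- item stmt-HubbardSuperconductivity-1210 · support · rank 7 · closed · proved by Summit.HubbardSuperconductivity.HubbardSuperconductivity.Theorems.wcbcsSourcedFreeGasCooperLog_proof (prover) · by planner
[support] COOPER LOGARITHM OF THE SOURCED FREE GAS as a finite-L operator inequality (card
probe-legendre-order-ceiling; the U=0 anchor of
Literature.MathematicalPhysics.QuantumLattice.dWaveSourceTorus when g = dWaveFormFactor). For every
g and δ∈(0,1) there are C, h₀ such that for 0<h<h₀ and L ≥ L₀(h) there is μ = μ_L ∈ [−4,4] — the
finite-L Fermi level, i.e. the (N_L/2)-th smallest free level ε_k = −2(cos k₁+cos k₂), k ∈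
(2π/L)ℤ_L² — with   K_μ − h(Δ_g + Δ_g†) ≥ E₀^{sec}(N_L) − μN_L − C h² log(1/h)·L²   on ALL of Fock
space, where K_μ = hubbardTorusWith 2 L 1 0 μ (free, grand-canonical) and E₀^{sec}(N_L) =
minEnergyOn of the free hubbardTorus 2 L 1 0 on szSector N_L 0. PROOF: (1) exact
canonical/grand-canonical match AT a level: E₀^{sec}(N_L) − μ_L N_L = Σ_{kσ} min(ε_k − μ_L, 0) (fill
the N_L/2 lowest levels per spin; levels equal to μ_L contribute 0, so shell degeneracy is
harmless); (2) momentum blocks: Δ_g = Σ_k ĝ(k) c_{k↑}c_{−k↓} with ĝ(k) = √2 Σ_e g(e) cos(k·e) real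
and bounded, K_μ − hO = Σ_k h_k, h_k = ξ_k(n_{k↑} + n_{−k↓}) − h ĝ_k (c_{k↑}c_{−k↓} + h.c.), and h_k
≥ λ_min(h_k)·1 with λ_min(h_k) = ξ_k − √(ξ_k² + h²ĝ_k²) (a 4×4 BdG block) — a LOWER bound needs no
Bogoliubov t -/
@[route_item "route-HubbardSuperconductivity-WeakCouplingBCS"]
def WcbcsSourcedFreeGasCooperLog : Prop :=
  ∀ (g : Literature.Probability.LatticeModels.Site 2 → ℝ) (δ : ℝ), δ ∈ Set.Ioo (0:ℝ) 1 → ∃ C h₀ : ℝ, 0 < h₀ ∧ h₀ < 1 ∧ ∀ h : ℝ, h ∈ Set.Ioo (0:ℝ) h₀ → ∃ L₀ : ℕ, ∀ L : ℕ, L₀ ≤ L → ∃ μ : ℝ, |μ| ≤ 4 ∧ ∀ φ : Literature.MathematicalPhysics.QuantumLattice.Fock (Literature.MathematicalPhysics.QuantumLattice.Orb (Literature.MathematicalPhysics.QuantumLattice.FermionTorus 2 (L + 1))), star φ ⬝ᵥ φ = 1 → (Literature.MathematicalPhysics.QuantumLattice.hubbardTorus 2 (L + 1) 1 0).minEnergyOn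 (Literature.MathematicalPhysics.QuantumLattice.szSector (2 * ⌊(1 - δ) * ((L + 1 : ℕ) : ℝ) ^ 2 / 2⌋₊) 0) - μ * ((2 * ⌊(1 - δ) * ((L + 1 : ℕ) : ℝ) ^ 2 / 2⌋₊ : ℕ) : ℝ) - C * h ^ 2 * Real.log (1 / h) * ((L + 1 : ℕ) : ℝ) ^ 2 ≤ (star φ ⬝ᵥ Matrix.mulVec (Literature.MathematicalPhysics.QuantumLattice.hubbardTorusWith 2 (L + 1) 1 0 μ - (h : ℂ) • (Literature.MathematicalPhysics.QuantumLattice.pairField g (L + 1) + Matrix.conjTranspose (Literature.MathematicalPhysics.QuantumLattice.pairField g (L + 1)))) φ).re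

/-- `WcbcsSourcedFreeGasCooperLog` holds: proved by `Summit.HubbardSuperconductivity.HubbardSuperconductivity.Theorems.wcbcsSourcedFreeGasCooperLog_proof`. -/
theorem WcbcsSourcedFreeGasCooperLog_holds : WcbcsSourcedFreeGasCooperLog := _root_.Summit.HubbardSuperconductivity.HubbardSuperconductivity.Theorems.wcbcsSourcedFreeGasCooperLog_proof

/-- item stmt-HubbardSuperconductivity-1211 · support · rank 8 · closed · proved by Summit.HubbardSuperconductivity.HubbardSuperconductivity.Theorems.wcbcsTowerTrialBudget_proof (prover) · by planner
[support] TOWER TRIAL-STATE BUDGET (card probe-legendre-order-ceiling; Koma–Tasaki Theorem 2.2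
'lite' + U·Σn↑n↓ ≥ 0 + Slater sandwich, all at finite L, any parity of L). For every g there is B =
B(g) such that for every L, U ≥ 0, μ, h ≥ 0, N, every normalised (N, S^z=0)-sector ground state Φ of
H_U = hubbardTorus 2 L 1 U with q := ‖OΦ‖² > 0 (O = Δ_g + Δ_g†) and every lower bound E of K_μ − hO
on unit vectors (K_μ = hubbardTorusWith 2 L 1 0 μ):   h·√q ≤ E₀^{sec,free}(N) + U N²/(4L²) − μN +
|μ| + B(1+U)L²/q − E,   E₀^{sec,free}(N) = minEnergyOn of hubbardTorus 2 L 1 0 on szSector N 0.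
PROOF: Ξ := (Φ + OΦ/√q)/√2 is a unit vector (⟨Φ,OΦ⟩ = 0 since O moves the particle number by ±2)
with ⟨Ξ,OΞ⟩ = √q (⟨Φ,O³Φ⟩ = 0 likewise), ⟨Ξ,N̂Ξ⟩ ∈ [N−1, N+1], and ⟨Ξ,H_UΞ⟩ = E_U +
⟨Φ,[[O,H_U],O]Φ⟩/(4q) (double-commutator identity for the eigenvector Φ, KT (2.9); the cross term
⟨Φ,H_U OΦ⟩ = E_U⟨Φ,OΦ⟩ = 0) ≤ E_U + B(1+U)L²/q by locality of the EVEN operators P_x (local pairs)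
and h_y (bond hopping, on-site U): only O(L²) triple commutators [[o_x,h_y],o_z] are non-zero, each
of norm ≤ c_g(1+U). NOTE: KT's printed hypothesis [o_x,o_y] = 0 fails for overlapping bond pairs
(P_x vs P_y†), so the norm bound is -/
@[route_item "route-HubbardSuperconductivity-WeakCouplingBCS"]
def WcbcsTowerTrialBudget : Prop :=
  ∀ (g : Literature.Probability.LatticeModels.Site 2 → ℝ), ∃ B : ℝ, ∀ (L : ℕ) [NeZero L] (U μ h : ℝ), 0 ≤ U → 0 ≤ h → ∀ (N : ℕ) (Φ : Literature.MathematicalPhysics.QuantumLattice.Fock (Literature.MathematicalPhysics.QuantumLattice.Orb (Literature.MathematicalPhysics.QuantumLattice.FermionTorus 2 L))), Literature.MathematicalPhysics.QuantumLattice.IsGroundStateInSector (Literature.MathematicalPhysics.QuantumLattice.hubbardTorus 2 L 1 U) N 0 Φ → star Φ ⬝ᵥ Φ = 1 → ∀ E : ℝ, (∀ φ : Literature.MathematicalPhysics.QuantumLattice.Fock (Literature.MathematicalPhysics.QuantumLattice.Orb (Literature.MathematicalPhysics.QuantumLattice.FermionTorus 2 L)), star φ ⬝ᵥ φ = 1 →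 E ≤ (star φ ⬝ᵥ Matrix.mulVec (Literature.MathematicalPhysics.QuantumLattice.hubbardTorusWith 2 L 1 0 μ - (h : ℂ) • (Literature.MathematicalPhysics.QuantumLattice.pairField g L + Matrix.conjTranspose (Literature.MathematicalPhysics.QuantumLattice.pairField g L))) φ).re) → 0 < (star (Matrix.mulVec (Literature.MathematicalPhysics.QuantumLattice.pairField g L + Matrix.conjTranspose (Literature.MathematicalPhysics.QuantumLattice.pairField g L)) Φ) ⬝ᵥ Matrix.mulVec (Literature.MathematicalPhysics.QuantumLattice.pairField g L + Matrix.conjTranspose (Literature.MathematicalPhysics.QuantumLattice.pairField g L)) Φ).re → h * Real.sqrt ((star (Matrix.mulVec (Literature.MathematicalPhysics.QuantumLattice.pairField g L + Matrix.conjTranspose (Literature.MathematicalPhysics.QuantumLattice.pairField g L)) Φ) ⬝ᵥ Matrix.mulVec (Literature.MathematicalPhysics.QuantumLattice.pairField g L + Matrix.conjTranspose (Literature.MathematicalPhysics.QuantumLattice.pairField g L)) Φ).re) ≤ (Literature.MathematicalPhysics.QuantumLattice.hubbardTorus 2 L 1 0).minEnergyOn (Literature.MathematicalPhysics.QuantumLattice.szSector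 N 0) + U * (N : ℝ) ^ 2 / (4 * (L : ℝ) ^ 2) - μ * (N : ℝ) + |μ| + B * (1 + U) * (L : ℝ) ^ 2 / (star (Matrix.mulVec (Literature.MathematicalPhysics.QuantumLattice.pairField g L + Matrix.conjTranspose (Literature.MathematicalPhysics.QuantumLattice.pairField g L)) Φ) ⬝ᵥ Matrix.mulVec (Literature.MathematicalPhysics.QuantumLattice.pairField g L + Matrix.conjTranspose (Literature.MathematicalPhysics.QuantumLattice.pairField g L)) Φ).re - E

/-- `WcbcsTowerTrialBudget` holds: proved by `Summit.HubbardSuperconductivity.HubbardSuperconductivity.Theorems.wcbcsTowerTrialBudget_proof`. -/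
theorem WcbcsTowerTrialBudget_holds : WcbcsTowerTrialBudget := _root_.Summit.HubbardSuperconductivity.HubbardSuperconductivity.Theorems.wcbcsTowerTrialBudget_proof

/-- item stmt-HubbardSuperconductivity-14261 · support · rank 9 · closed · proved by Summit.HubbardSuperconductivity.HubbardSuperconductivity.Theorems.wcbcsThesisGlue_proof (prover) · by planner
sources: KomaTasaki1994 §0.7 (arXiv:cond-mat/9708132), RaghuKivelsonScalapino2010 §II–III (arXiv:1002.0591), Literature.MathematicalPhysics.QuantumLattice.hasDWaveOrder_iff (DWaveSource.lean)
[support] GLUE INTO THE TARGET, by item NAME (rev 4, route-choice repair (a): clears the hold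
`target-unreachable` on WcbcsThesis — after rev 3 dropped the inlined rev-2 glue WcbcsCruxGlue no
item concluded X). crux 2 → crux 4 → X: take U₀ := min(U₀ of WcbcsBcsConstruction, U₁ of
WcbcsSsbToTorusLRO); the construction fixes δ ∈ (0,1/2) and C > 0 and gives, for each U ∈ (0,U₀), a
density-matched μ with dWaveOrderParameter U μ ≥ e^{-C/U²} > 0, i.e. HasDWaveOrder U μ
(hasDWaveOrder_iff), and the transfer crux turns it into HasDWavePairFieldLROAt U δ — which is X at
(U₀, δ). PROVABLE NOW, pure logic; planner sketch (lean check rc 0, 0 sorries, axioms ⊆ {propext,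
Classical.choice, Quot.sound}): `rintro ⟨U₁, hU₁, h2⟩ ⟨δ, hδ, U₀, hU₀, C, _, h4⟩; refine ⟨min U₀ U₁,
lt_min hU₀ hU₁, δ, hδ, fun U hU => ?_⟩; obtain ⟨μ, hd, hm⟩ := h4 U ⟨hU.1, lt_of_lt_of_le hU.2
(min_le_left _ _)⟩; exact h2 U ⟨hU.1, lt_of_lt_of_le hU.2 (min_le_right _ _)⟩ δ hδ μ hd
((hasDWaveOrder_iff _ _).2 (lt_of_lt_of_le (Real.exp_pos _) hm))`. Names, not bodies: this item
cannot go stale under a restatement of X or of either crux (the defect that retired WcbcsCruxGlue,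
stmt-2011). PROVER: per the header, do NOT import this T -/
@[route_item "route-HubbardSuperconductivity-WeakCouplingBCS"]
def WcbcsThesisGlue : Prop :=
  WcbcsSsbToTorusLRO → WcbcsBcsConstruction → WcbcsThesis

/-- `WcbcsThesisGlue` holds: proved by `Summit.HubbardSuperconductivity.HubbardSuperconductivity.Theorems.wcbcsThesisGlue_proof`. -/
theorem WcbcsThesisGlue_holds : WcbcsThesisGlue := _root_.Summit.HubbardSuperconductivity.HubbardSuperconductivity.Theorems.wcbcsThesisGlue_proof

/-- item stmt-HubbardSuperconductivity-19165 · support · rank 9 · open · by planner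
[support] LADDER-Hubbard rung R2d, OPTIONAL theorem-half leaf R2dH1′ (KL-ONSET form, DECOMP App. B
H1.i-a′; director Q-a 2026-08-25T23:31Z): for every η ∈ (0,1) there is U₀(η) > 0 such that for all δ
∈ [0.10, 0.20], 0 < U ≤ U₀ and 0 < β ≤ exp((1−η)·(2π)²/(klCoefficientB1g(μ_δ)·U²)) — i.e. down to a
fixed fraction (in log scale) of the d-wave Kohn–Luttinger onset β_KL = e^{1/(a_B1g U²)}, a_B1g =
klCoefficientB1g/(2π)² = 0.0105 (δ 0.10) … 0.0050 (δ 0.20) — the thermal two-point functions of the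
repulsive 2D Hubbard model at μ_δ = chemicalPotentialOfDensity (squareDispersion 1 0) (1−δ) have a
thermodynamic limit. klCoefficientB1g μ is inlined as −channelInf (squareDispersion 1 0) μ 1
D4Irrep.B1g (the B1g bottom of the χ₀ pairing form; the constant U drops out of B1g). Ties the two
halves of R2d together (the certified selected channel sets the control scale); sharper in scale and
narrower in window than the leaf of record H1TwoPointLimitKLScaleD (δ ∈ [0.10, 0.35], ∃ c); reached
by route KLProgramme's method by design (bc9 ladder_ceiling capped-at-(1−η)·KL-onset) but NOT by its
current cruxes (K3 gives ∃ c) — a K3′ onset-regime crux would be a DECOMP v7 matter if the human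
makes this T -/
@[route_item "route-HubbardSuperconductivity-WeakCouplingBCS"]
def H1TwoPointLimitKLOnsetD : Prop :=
  ∀ η : ℝ, 0 < η → η < 1 → ∃ U₀ : ℝ, 0 < U₀ ∧ ∀ δ ∈ Set.Icc (0.10 : ℝ) 0.20, ∀ U β : ℝ, 0 < U → U ≤ U₀ → 0 < β → β ≤ Real.exp ((1 - η) * (2 * Real.pi) ^ 2 / ((- Literature.MathematicalPhysics.QuantumLattice.channelInf (Literature.MathematicalPhysics.QuantumLattice.squareDispersion 1 0) (Literature.MathematicalPhysics.QuantumLattice.chemicalPotentialOfDensity (Literature.MathematicalPhysics.QuantumLattice.squareDispersion 1 0) (1 - δ)) 1 Literature.MathematicalPhysics.QuantumLattice.D4Irrep.B1g) * U ^ 2)) → ∀ (x y : Literature.Probability.LatticeModels.Site 2) (σ σ' : Fin 2), ∃ S : ℂ, Filter.Tendsto (fun L : ℕ => Literature.MathematicalPhysics.QuantumLattice.hubbardThermalTwoPoint β U (Literature.MathematicalPhysics.QuantumLattice.chemicalPotentialOfDensity (Literature.MathematicalPhysics.QuantumLattice.squareDispersion 1 0) (1 - δ)) L x y σ σ') Filter.atTop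 (nhds S)

/-- item stmt-HubbardSuperconductivity-19293 · support · rank 9 · closed · proved by Summit.HubbardSuperconductivity.HubbardSuperconductivity.Theorems.KlCertQuad.fermiCurveMassD010 (prover) · by planner
[support] R2dCERT first rung R2 (eng ENCLOSURES-SCOPE.md (c)/(d)2, director-hubbard
2026-08-26T02:49:01Z; DECOMP §9′): the total density-of-states mass of the free square-lattice Fermi
curve at the record chemical potential μ₀ = −3239529283960145/2⁵⁴ = −0.17983 (δ ≈ 0.10; the single
box of klCertB1gD010), σ_{μ₀}(ℝ²) = ∫_{(−π,π]} fermiPolarDOS μ₀ θ dθ = 2K(1 − μ₀²/16) = 8.98019…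
enclosed to 1 % in [8.89, 9.07]. Record-AGNOSTIC (Literature decls only). PURPOSE: the kernel-time
probe (L4) of verified quadrature against σ_{μ₀} — it exercises exactly the shared trunk T2 (w(θ) =
u_μ(θ)/∂_tF(θ,u_μ(θ)), u by certified bisection via strictMonoOn_rayDispersion_band) + T3 (dyadic
interval kit: cos/sin enclosures, Riemann brackets, the π/4 end-cell, D₄ reduction ∫ = 8∫_{[0,π/4]})
of the in-kernel discharge of klCertB1gD010.EnclosuresB1g (REF-CHECK §8.7 (α)), and NOTHING of T4
(Lindhard hulls). DELIVERABLE with the proof: kernel wall-time and bignum-op count per cell / per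
hull theorem on STATUS (decides `decide`-with-dyadic-truncation vs `native_decide` empirically;
director 02:49:01Z (2)). Why it might fail: it cannot mathematically (true value 8.980 at the centre
of a ±1 % window); the risk -/
@[route_item "route-HubbardSuperconductivity-WeakCouplingBCS"]
def FermiCurveMassD010 : Prop :=
  (Literature.MathematicalPhysics.QuantumLattice.fermiCurveMeasure (Literature.MathematicalPhysics.QuantumLattice.squareDispersion 1 0) ((-3239529283960145 / 18014398509481984 : ℚ) : ℝ) Set.univ).toReal ∈ Set.Icc (889 / 100 : ℝ) (907 / 100)

/-- `FermiCurveMassD010` holds: proved by `Summit.HubbardSuperconductivity.HubbardSuperconductivity.Theorems.KlCertQuad.fermiCurveMassD010`. -/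
theorem FermiCurveMassD010_holds : FermiCurveMassD010 := _root_.Summit.HubbardSuperconductivity.HubbardSuperconductivity.Theorems.KlCertQuad.fermiCurveMassD010

/-- item stmt-HubbardSuperconductivity-19294 · support · rank 9 · closed · proved by Summit.HubbardSuperconductivity.HubbardSuperconductivity.Theorems.lindhardPointwiseIdentification_proof (prover) · by planner
[support] LINDHARD s-REPRESENTATION, POINTWISE (closes REF-CHECK §8.7 (β) = CERT-SREP Prop. 2's
«a.e. μ / continuity points» caveat INSIDE THE TREE, for BOTH Kohn–Luttinger certificates
stmt-HubbardSuperconductivity-0158 (WcbcsKohnLuttingerB1g, R2d) and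
stmt-HubbardSuperconductivity-1741 (ChiralWindow); director-hubbard 2026-08-26T02:49:01Z (S-b); eng
ENCLOSURES-SCOPE.md (b) route A (i)–(iii), (d)2). For every −4 < μ < 0 and every q ∉ 2πℤ² (some
coordinate not an integer multiple of 2π): lindhardFunction ε₀ μ q = F(q; μ) := ∫₀¹ ρ(μ; A₀(s),
A₁(s)) ds with A_i(s) = √(1 − 4s(1−s) sin²(q_i/2)) and ρ(E; a, b) := (2π)⁻² · (fermiCurveMeasure (k
↦ −2(a cos k₀ + b cos k₁)) E)(univ) = the COAREA density of states of the anisotropic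
nearest-neighbour band (total mass of its 1/|∇ε|-weighted arc-length measure on {ε = E} ∩ [−π,π)²),
typed INLINE over Literature decls only (no new definition needed; a later
`LindhardSRepresentation.lean` may name ρ and prove the closed form ρ = K(m)/(2π²√(ab)) (CERT-SREP
(1.1), Gradshteyn–Ryzhik 3.147) — that closed form is T4's business, NOT part of this item). PROOF
PLAN (CERT-SREP §1 + eng (iii)): (i) amplitude identity (1−s)cos k + s cos(k+q) = A cos(k+φ); ( -/
@[route_item "route-HubbardSuperconductivity-WeakCouplingBCS"]
def LindhardPointwiseIdentification : Prop :=
  ∀ μ ∈ Set.Ioo (-4 : ℝ) 0, ∀ q : Literature.MathematicalPhysics.QuantumLattice.Momentum, (∃ i : Fin 2, ∀ n : ℤ, q i ≠ 2 * Real.pi * n) → Literature.MathematicalPhysics.QuantumLattice.lindhardFunction (Literature.MathematicalPhysics.QuantumLattice.squareDispersion 1 0) μ q = (∫ s in (0 : ℝ)..1, (Literature.MathematicalPhysics.QuantumLattice.fermiCurveMeasure (fun k : Literature.MathematicalPhysics.QuantumLattice.Momentum => -2 * (Real.sqrt (1 - 4 * s * (1 - s) * Real.sin (q 0 / 2) ^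 2) * Real.cos (k 0) + Real.sqrt (1 - 4 * s * (1 - s) * Real.sin (q 1 / 2) ^ 2) * Real.cos (k 1))) μ Set.univ).toReal) / (2 * Real.pi) ^ 2

-- `LindhardPointwiseIdentification` holds: proved by `Summit.HubbardSuperconductivity.HubbardSuperconductivity.Theorems.lindhardPointwiseIdentification_proof` (its module imports this route file, so no `_holds` link can be stated here).

/-- item stmt-HubbardSuperconductivity-19419 · support · rank 9 · open · by planner
[support] rung-R2d LEAF, theorem half (LADDER-Hubbard R2d; DECOMP.md §1/§8 of cell gate-hubbard-kl;
D-0061 closes-target for route KLProgramme): thermodynamic limit of the equal-time thermal two-point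
function ⟨c†_{xσ}c_{yσ′}⟩_{β,L} of the repulsive square-lattice Hubbard torus at the free-band
chemical potential μ(δ) of hole doping δ ∈ [0.10, 0.35], for all 0 < U ≤ U₀ and 0 < β ≤ exp(c/U²)
(some U₀, c > 0) — the NORMAL-PHASE half of crux WcbcsBcsConstruction one rung down (T > 0 down to
the Kohn–Luttinger scale, no gap equation), i.e. the Benfatto–Giuliani–Mastropietro theorem pushed
(i) to intermediate filling and (ii) past the sign-blind ceiling β ≤ exp(a/U) by a sign-resolved
Cooper-channel flow seeded by the certified B1g kernel (support WcbcsKohnLuttingerB1g). Word for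
word the g2 leaf `H1TwoPointLimitKLScaleDoping 0.10 0.35` (HOME/planner-g2/Sketch.lean; =
Literature…HubbardKLProgramme.H1TwoPointLimitKLScaleD when that vocabulary module lands — this
Theses decl is the leaf OF RECORD). Decided by route KLProgramme: closes : H10TwoPointLimit →
KLRegimeTwoPointLimit → H1TwoPointLimitKLScaleD (HOME/planner-g3 package). Sources:
BenfattoGiulianiMastropietro2006 (arXiv:cond-mat/05 -/
@[route_item "route-HubbardSuperconductivity-WeakCouplingBCS"]
def H1TwoPointLimitKLScaleD : Prop :=
  ∃ U₀ c : ℝ, 0 < U₀ ∧ 0 < c ∧ ∀ δ ∈ Set.Icc (0.10 : ℝ) 0.35, ∀ U β : ℝ, 0 < U → U ≤ U₀ → 0 < β → β ≤ Real.exp (c / U ^ 2) → ∀ (x y : Literature.Probability.LatticeModels.Site 2) (σ σ' : Fin 2), ∃ S : ℂ, Filter.Tendsto (fun L : ℕ => Literature.MathematicalPhysics.QuantumLattice.hubbardThermalTwoPoint β U (Literature.MathematicalPhysics.QuantumLattice.chemicalPotentialOfDensity (Literature.MathematicalPhysics.QuantumLattice.squareDispersion 1 0) (1 - δ)) L x y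 σ σ') Filter.atTop (nhds S)

-- earlier Assembly (stmt-HubbardSuperconductivity-0156, replaced 2026-08-15T11:00:15Z -> stmt-HubbardSuperconductivity-2008): retired by None — (∃ U₀ : ℝ, 0 < U₀ ∧ ∃ δ ∈ Set.Ioo (0:ℝ) 1, ∀ U ∈ Set.Ioo (0:ℝ) U₀, ∀ (N : ℕ → ℕ) (ψ : ∀ L, Literature.MathematicalPhysics.QuantumLattice.Fock (Literature.MathematicalPhysics.QuantumLattice.Orb (Literature.MathematicalPhysics.QuantumLattice.FermionTorus 2 L))
-- earlier Assembly (stmt-HubbardSuperconductivity-2008, replaced 2026-08-15T16:18:10Z -> stmt-HubbardSuperconductivity-10544): retired by None — (∃ U₀ : ℝ, 0 < U₀ ∧ ∃ δ ∈ Set.Ioo (0:ℝ) (1 / 2), ∀ U ∈ Set.Ioo (0:ℝ) U₀, Literature.Barriers.HubbardSuperconductivity.HasDWavePairFieldLROAt U δ) → HubbardSuperconductivity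
/-- item stmt-HubbardSuperconductivity-10544 · assembly · rank 1 · closed · proved by Summit.HubbardSuperconductivity.HubbardSuperconductivity.Theorems.weakCouplingBCS_assembly_structural (prover) · by planner
sources: Summits/HubbardSuperconductivity/HubbardSuperconductivity/Statement.lean (audit 2026-08-13), Literature.Barriers.HubbardSuperconductivity.HasDWavePairFieldLROAt
[assembly] crux 2 → crux 4 → HubbardSuperconductivity, by item NAME (rev 3; the rev-2 form X → S
with X inlined is retired). Its proof is the route’s deciding theorem `closes` in this file: U :=
min(U₀,U₁)/2 at the density-matched μ of WcbcsBcsConstruction, m ≥ e^{-C/U²} > 0 gives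
HasDWaveOrder, WcbcsSsbToTorusLRO gives HasDWavePairFieldLROAt U δ, and the summit is ∃U>0 ∃δ∈Ioo 0
(1/2) HasDWavePairFieldLROAt U δ (Iff.rfl). Bookkeeping only — provers attack the cruxes, not this
item. -/
@[route_item "route-HubbardSuperconductivity-WeakCouplingBCS"]
def Assembly : Prop :=
  WcbcsSsbToTorusLRO → WcbcsBcsConstruction → _root_.HubbardSuperconductivity

/-- `Assembly` holds: proved by `Summit.HubbardSuperconductivity.HubbardSuperconductivity.Theorems.weakCouplingBCS_assembly_structural`. -/
theorem Assembly_holds : Assembly := _root_.Summit.HubbardSuperconductivity.HubbardSuperconductivity.Theorems.weakCouplingBCS_assembly_structural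

-- records of items no longer active in this route (dropped / restated):
-- earlier WcbcsSectorBookkeeping (stmt-HubbardSuperconductivity-0160, dropped 2026-08-15T11:00:15Z): proved by Summit.HubbardSuperconductivity.WeakCouplingBCS.wcbcsSectorBookkeeping_proof — ∀ (U δ : ℝ), δ ∈ Set.Ioo (0:ℝ) 1 → ∀ (N : ℕ → ℕ) (ψ : ∀ L, Literature.MathematicalPhysics.QuantumLattice.Fock (Literature.MathematicalPhysics.QuantumLattice.Orb (Literature.MathematicalPhysics.QuantumLattice.Ferm

/-! D-0027 §2.1 — DECIDING THEOREM (planner-authored via `route open/edit --closes-file`; by planner-rbadge-HubbardSuperconductivity-WeakCo-822f3ecf-g2-0 2026-08-15T16:18:10Z):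
its hypotheses are this route's items and its conclusion the sub-problem Statement (glue_lint), and it elaborates with this file. -/

@[closes "route-HubbardSuperconductivity-WeakCouplingBCS"] theorem closes (hSsb : WcbcsSsbToTorusLRO) (hBcs : WcbcsBcsConstruction) :
    _root_.HubbardSuperconductivity := by
  obtain ⟨U₁, hU₁, h2⟩ := hSsb
  obtain ⟨δ, hδ, U₀, hU₀, C, _hC, h4⟩ := hBcs
  have hpos : (0 : ℝ) < min U₀ U₁ / 2 := half_pos (lt_min hU₀ hU₁)
  have hlt : min U₀ U₁ / 2 < min U₀ U₁ := half_lt_self (lt_min hU₀ hU₁)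
  obtain ⟨μ, hdens, hm⟩ := h4 (min U₀ U₁ / 2) ⟨hpos, lt_of_lt_of_le hlt (min_le_left U₀ U₁)⟩
  have hord : Literature.MathematicalPhysics.QuantumLattice.HasDWaveOrder (min U₀ U₁ / 2) μ :=
    (Literature.MathematicalPhysics.QuantumLattice.hasDWaveOrder_iff _ _).2
      (lt_of_lt_of_le (Real.exp_pos _) hm)
  have hX : Literature.Barriers.HubbardSuperconductivity.HasDWavePairFieldLROAt (min U₀ U₁ / 2) δ :=
    h2 (min U₀ U₁ / 2) ⟨hpos, lt_of_lt_of_le hlt (min_le_right U₀ U₁)⟩ δ hδ μ hdens hord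
  exact ⟨min U₀ U₁ / 2, hpos, δ, hδ, hX⟩

end Summit.HubbardSuperconductivity.HubbardSuperconductivity.Theses.WeakCouplingBCS
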